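import Summits.ValiantsHypothesis.ValiantsHypothesis.Theorems.SymPencilPerFourColSixForms

/-!
# Route `SymPencil` — the space `W₂ = row 0 ⊕ span(E₁₀, E₁₁)` at size `27`, I: the two-row base
# point `v = t'(E₀₁+E₀₂+E₀₃) + t E₁₀` (`--supports` stmt-ValiantsHypothesis-5674
# `SdcSuperquadratic`; cell `(10,6,6)` of the size-`27` kernel-package table; rung currency only,
# nothing here bears on `VP ≠ VNP`)

Third coordinate survivor of the census of `Cruxes/SdcSuperquadratic/PENCIL-CROSS-27.md` (§W₂,
rev 6).  This file is the analogue of `SymPencilPerFourColSixTwoRow` / `…ColSixPair` for the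
two-row kernel vector `v` of `W₂` with rows `(0,t',t',t')`, `(t,0,0,0)`:
* `eval_w2_tworow`: `per_4 (z + s v) = per_4 z + s ∂_v per_4 z + s² · t t' · (Q₂₃+Q₁₃+Q₁₂)(z)`,
  `Q_{pq} = z₂ₚz₃q + z₂qz₃ₚ`;
* `w2_basepoint_form`: `det (D + C(v)) · (bL z ⬝ (D + C(v))⁻¹ bL z') = -κ B_v(z,z')`;
* `w2_pair_vanish`: if `bL x' = (D + C(v))D⁻¹ bL z''` then `x'₂₁ = x'₂₂ = x'₂₃ = 0` and
  `x'₃₁ = x'₃₂ = x'₃₃ = 0` (`t t' ≠ 0`): the translate `(D + C(v))D⁻¹ (im bL)` meets `im bL` only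
  in rows of `span(E₁₂, E₁₃, E₂₀, E₃₀)` (modulo the kernel).
No definitions, no named facts. [folklore]
-/

noncomputable section

-- single-conjunct layout: Sub = Summit, duplicated namespace component intended
set_option linter.dupNamespace false

namespace Summit.ValiantsHypothesis.ValiantsHypothesis.Theorems.SymPencilPerFourW2TwoRow

open Matrix MvPolynomial Module
open Literature.Computability.AlgebraicComplexity
open Summit.ValiantsHypothesis.ValiantsHypothesis.Theorems.SymPencilLagrangianKernel
open Summit.ValiantsHypothesis.ValiantsHypothesis.Theorems.SymPencilBasePointFamily
open Literature.Computability.AlgebraicComplexity.AlperBogartVelasco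

universe u

variable {k : Type u} [Field k]

/-- **The pencil through the two-row point `v = t'(E₀₁+E₀₂+E₀₃) + tE₁₀`**: explicit expansion of
`per_4 (z + s v)`; the `s²`-coefficient is `t t' (Q₂₃ + Q₁₃ + Q₁₂)(z)`. [folklore] -/
theorem eval_w2_tworow (z : Fin 4 × Fin 4 → k) (t t' s : k) :
    MvPolynomial.eval (z + s • (fun w : Fin 4 × Fin 4 =>
        (Matrix.of ![![0, t', t', t'], ![t, 0, 0, 0], ![0, 0, 0, 0], ![0, 0, 0, 0]]) w.1 w.2)) (perPoly (Fin 4) k) =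
      MvPolynomial.eval z (perPoly (Fin 4) k) +
      s * (t * z (0, 1) * z (2, 2) * z (3, 3) + t * z (0, 1) * z (2, 3) * z (3, 2) +
        t * z (0, 2) * z (2, 1) * z (3, 3) + t * z (0, 2) * z (2, 3) * z (3, 1) +
        t * z (0, 3) * z (2, 1) * z (3, 2) + t * z (0, 3) * z (2, 2) * z (3, 1) +
        t' * z (1, 0) * z (2, 1) * z (3, 2) + t' * z (1, 0) * z (2, 1) * z (3, 3) +
        t' * z (1, 0) * z (2, 2) * z (3, 1) + t' * z (1, 0) * z (2, 2) * z (3, 3) +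
        t' * z (1, 0) * z (2, 3) * z (3, 1) + t' * z (1, 0) * z (2, 3) * z (3, 2) +
        t' * z (1, 1) * z (2, 0) * z (3, 2) + t' * z (1, 1) * z (2, 0) * z (3, 3) +
        t' * z (1, 1) * z (2, 2) * z (3, 0) + t' * z (1, 1) * z (2, 3) * z (3, 0) +
        t' * z (1, 2) * z (2, 0) * z (3, 1) + t' * z (1, 2) * z (2, 0) * z (3, 3) +
        t' * z (1, 2) * z (2, 1) * z (3, 0) + t' * z (1, 2) * z (2, 3) * z (3, 0) +
        t' * z (1, 3) * z (2, 0) * z (3, 1) + t' * z (1, 3) * z (2, 0) * z (3, 2) +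
        t' * z (1, 3) * z (2, 1) * z (3, 0) + t' * z (1, 3) * z (2, 2) * z (3, 0)) +
      s ^ 2 * (t * t' * (z (2, 1) * z (3, 2) + z (2, 2) * z (3, 1) +
        (z (2, 1) * z (3, 3) + z (2, 3) * z (3, 1)) + (z (2, 2) * z (3, 3) + z (2, 3) * z (3, 2)))) := by
  simp only [eval_perPoly, Matrix.permanent_fin_four_row, Matrix.of_apply, Pi.add_apply,
    Pi.smul_apply, smul_eq_mul]
  simp
  ring

variable [CharZero k] {ι' : Type*} [Fintype ι'] [DecidableEq ι']

/-- **The base-point identity along `v`** (polarised):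
`det (D + CL v) · (bL z ⬝ (D + CL v)⁻¹ bL z') = -κ · B_v(z,z')`. [folklore] -/
theorem w2_basepoint_form {D : Matrix ι' ι' k} (hDs : Dᵀ = D)
    (bL : (Fin 4 × Fin 4 → k) →ₗ[k] (ι' → k)) (CL : (Fin 4 × Fin 4 → k) →ₗ[k] Matrix ι' ι' k)
    (hCs : ∀ z, (CL z)ᵀ = CL z) {κ : k} (hκ : κ ≠ 0)
    (hN : ∀ v, bL v = 0 → IsUnit (D + CL v).det ∧ ∀ (z : Fin 4 × Fin 4 → k) (s : k),
      κ * MvPolynomial.eval (v + s • z) (perPoly (Fin 4) k) =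
        (Matrix.fromBlocks ((s * 0) • (1 : Matrix Unit Unit k))
          (Matrix.replicateRow Unit (s • bL z)) (Matrix.replicateCol Unit (s • bL z))
          (D + CL v + s • CL z)).det)
    (t t' : k) (hv : bL (fun w : Fin 4 × Fin 4 =>
        (Matrix.of ![![0, t', t', t'], ![t, 0, 0, 0], ![0, 0, 0, 0], ![0, 0, 0, 0]]) w.1 w.2) = 0) (z z' : Fin 4 × Fin 4 → k) :
    (D + CL (fun w : Fin 4 × Fin 4 =>
        (Matrix.of ![![0, t', t', t'], ![t, 0, 0, 0], ![0, 0, 0, 0], ![0, 0, 0, 0]]) w.1 w.2)).det * (bL z ⬝ᵥ (D + CL (fun w : Fin 4 × Fin 4 =>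
        (Matrix.of ![![0, t', t', t'], ![t, 0, 0, 0], ![0, 0, 0, 0], ![0, 0, 0, 0]]) w.1 w.2))⁻¹ *ᵥ bL z') =
      -(κ * (t * t' * (z (2, 1) * z' (3, 2) + z' (2, 1) * z (3, 2) + z (2, 2) * z' (3, 1) +
          z' (2, 2) * z (3, 1) +
        (z (2, 1) * z' (3, 3) + z' (2, 1) * z (3, 3) + z (2, 3) * z' (3, 1) + z' (2, 3) * z (3, 1)) +
        (z (2, 2) * z' (3, 3) + z' (2, 2) * z (3, 3) + z (2, 3) * z' (3, 2) + z' (2, 3) * z (3, 2)))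
        / 2)) := by
  set v : Fin 4 × Fin 4 → k := (fun w : Fin 4 × Fin 4 =>
        (Matrix.of ![![0, t', t', t'], ![t, 0, 0, 0], ![0, 0, 0, 0], ![0, 0, 0, 0]]) w.1 w.2) with hvdef
  have hS : ∀ w : Fin 4 × Fin 4 → k, (D + CL v).det * (bL w ⬝ᵥ (D + CL v)⁻¹ *ᵥ bL w) =
      -(κ * (t * t' * (w (2, 1) * w (3, 2) + w (2, 2) * w (3, 1) +
        (w (2, 1) * w (3, 3) + w (2, 3) * w (3, 1)) + (w (2, 2) * w (3, 3) + w (2, 3) * w (3, 2))))) := by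
    intro w
    exact (basepoint_family bL CL hN hκ v hv w _ _ _
      (fun s => by rw [hvdef]; exact eval_w2_tworow w t t' s)).1
  have hsym : ((D + CL v)⁻¹)ᵀ = (D + CL v)⁻¹ := by
    rw [Matrix.transpose_nonsing_inv, Matrix.transpose_add, hDs, hCs]
  have hsw : bL z' ⬝ᵥ (D + CL v)⁻¹ *ᵥ bL z = bL z ⬝ᵥ (D + CL v)⁻¹ *ᵥ bL z' := by
    rw [dotProduct_mulVec_of_transpose_eq hsym, dotProduct_comm]
  have h1 := hS (z + z')
  have h2 := hS z
  have h3 := hS z'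
  rw [map_add, Matrix.mulVec_add, dotProduct_add, add_dotProduct, add_dotProduct, hsw] at h1
  simp only [Pi.add_apply] at h1
  linear_combination (h1 - h2 - h3) / 2

/-- **Pair vanishing for `W₂`.**  If `bL x' = (D + CL v)D⁻¹ bL z''` (`v` the two-row base point,
`t t' ≠ 0`), then rows `2, 3` of `x'` vanish off column `0`:
`x'₂₁ = x'₂₂ = x'₂₃ = 0` and `x'₃₁ = x'₃₂ = x'₃₃ = 0`. [folklore] -/
theorem w2_pair_vanish {D : Matrix ι' ι' k} (hDs : Dᵀ = D)
    (bL : (Fin 4 × Fin 4 → k) →ₗ[k] (ι' → k)) (CL : (Fin 4 × Fin 4 → k) →ₗ[k] Matrix ι' ι' k)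
    (hCs : ∀ z, (CL z)ᵀ = CL z) {κ : k} (hκ : κ ≠ 0)
    (hi : ∀ z, bL z ⬝ᵥ D⁻¹ *ᵥ bL z = 0)
    (hN : ∀ v, bL v = 0 → IsUnit (D + CL v).det ∧ ∀ (z : Fin 4 × Fin 4 → k) (s : k),
      κ * MvPolynomial.eval (v + s • z) (perPoly (Fin 4) k) =
        (Matrix.fromBlocks ((s * 0) • (1 : Matrix Unit Unit k))
          (Matrix.replicateRow Unit (s • bL z)) (Matrix.replicateCol Unit (s • bL z))
          (D + CL v + s • CL z)).det)
    (t t' : k) (ht : t ≠ 0) (ht' : t' ≠ 0) (hv : bL (fun w : Fin 4 × Fin 4 =>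
        (Matrix.of ![![0, t', t', t'], ![t, 0, 0, 0], ![0, 0, 0, 0], ![0, 0, 0, 0]]) w.1 w.2) = 0)
    (x' z'' : Fin 4 × Fin 4 → k)
    (hy : bL x' = ((D + CL (fun w : Fin 4 × Fin 4 =>
        (Matrix.of ![![0, t', t', t'], ![t, 0, 0, 0], ![0, 0, 0, 0], ![0, 0, 0, 0]]) w.1 w.2)) * D⁻¹) *ᵥ bL z'') :
    (x' (2, 1) = 0 ∧ x' (2, 2) = 0 ∧ x' (2, 3) = 0) ∧
      (x' (3, 1) = 0 ∧ x' (3, 2) = 0 ∧ x' (3, 3) = 0) := by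
  set v : Fin 4 × Fin 4 → k := (fun w : Fin 4 × Fin 4 =>
        (Matrix.of ![![0, t', t', t'], ![t, 0, 0, 0], ![0, 0, 0, 0], ![0, 0, 0, 0]]) w.1 w.2) with hvdef
  have hu : IsUnit (D + CL v).det := (hN v hv).1
  have hDis : (D⁻¹)ᵀ = D⁻¹ := by rw [Matrix.transpose_nonsing_inv, hDs]
  have hzero : ∀ z, bL z ⬝ᵥ (D + CL v)⁻¹ *ᵥ bL x' = 0 := by
    intro z
    rw [hy, Matrix.mulVec_mulVec, ← Matrix.mul_assoc, Matrix.nonsing_inv_mul _ hu, Matrix.one_mul]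
    have h := hi (z + z'')
    rw [map_add, Matrix.mulVec_add, dotProduct_add, add_dotProduct, add_dotProduct, hi z, hi z'',
      dotProduct_mulVec_of_transpose_eq hDis (bL z''), dotProduct_comm (_ *ᵥ bL z''), zero_add,
      add_zero, ← two_mul] at h
    exact (mul_eq_zero.1 h).resolve_left two_ne_zero
  have hform := fun z => w2_basepoint_form hDs bL CL hCs hκ hN t t' hv z x'
  have e21 := hform (fun w : Fin 4 × Fin 4 =>
    (Matrix.of ![![(0 : k), 0, 0, 0], ![0, 0, 0, 0], ![0, 1, 0, 0], ![0, 0, 0, 0]]) w.1 w.2)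
  have e22 := hform (fun w : Fin 4 × Fin 4 =>
    (Matrix.of ![![(0 : k), 0, 0, 0], ![0, 0, 0, 0], ![0, 0, 1, 0], ![0, 0, 0, 0]]) w.1 w.2)
  have e23 := hform (fun w : Fin 4 × Fin 4 =>
    (Matrix.of ![![(0 : k), 0, 0, 0], ![0, 0, 0, 0], ![0, 0, 0, 1], ![0, 0, 0, 0]]) w.1 w.2)
  have e31 := hform (fun w : Fin 4 × Fin 4 =>
    (Matrix.of ![![(0 : k), 0, 0, 0], ![0, 0, 0, 0], ![0, 0, 0, 0], ![0, 1, 0, 0]]) w.1 w.2)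
  have e32 := hform (fun w : Fin 4 × Fin 4 =>
    (Matrix.of ![![(0 : k), 0, 0, 0], ![0, 0, 0, 0], ![0, 0, 0, 0], ![0, 0, 1, 0]]) w.1 w.2)
  have e33 := hform (fun w : Fin 4 × Fin 4 =>
    (Matrix.of ![![(0 : k), 0, 0, 0], ![0, 0, 0, 0], ![0, 0, 0, 0], ![0, 0, 0, 1]]) w.1 w.2)
  rw [hzero, mul_zero] at e21 e22 e23 e31 e32 e33
  simp only [Matrix.of_apply, Matrix.cons_val, mul_zero, zero_mul, add_zero,
    zero_add, mul_one, one_mul] at e21 e22 e23 e31 e32 e33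
  have hc : κ * (t * t') ≠ 0 := mul_ne_zero hκ (mul_ne_zero ht ht')
  -- `e2p`: `(x'₃q + x'₃r) = 0` for `{p,q,r} = {1,2,3}`; `e3p` likewise for row `2`
  have f21 : x' (3, 2) + x' (3, 3) = 0 := by
    have h : κ * (t * t') * (x' (3, 2) + x' (3, 3)) = 0 := by linear_combination (2 : k) * e21
    exact (mul_eq_zero.1 h).resolve_left hc
  have f22 : x' (3, 1) + x' (3, 3) = 0 := by
    have h : κ * (t * t') * (x' (3, 1) + x' (3, 3)) = 0 := by linear_combination (2 : k) * e22
    exact (mul_eq_zero.1 h).resolve_left hc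
  have f23 : x' (3, 1) + x' (3, 2) = 0 := by
    have h : κ * (t * t') * (x' (3, 1) + x' (3, 2)) = 0 := by linear_combination (2 : k) * e23
    exact (mul_eq_zero.1 h).resolve_left hc
  have f31 : x' (2, 2) + x' (2, 3) = 0 := by
    have h : κ * (t * t') * (x' (2, 2) + x' (2, 3)) = 0 := by linear_combination (2 : k) * e31
    exact (mul_eq_zero.1 h).resolve_left hc
  have f32 : x' (2, 1) + x' (2, 3) = 0 := by
    have h : κ * (t * t') * (x' (2, 1) + x' (2, 3)) = 0 := by linear_combination (2 : k) * e32
    exact (mul_eq_zero.1 h).resolve_left hc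
  have f33 : x' (2, 1) + x' (2, 2) = 0 := by
    have h : κ * (t * t') * (x' (2, 1) + x' (2, 2)) = 0 := by linear_combination (2 : k) * e33
    exact (mul_eq_zero.1 h).resolve_left hc
  refine ⟨⟨?_, ?_, ?_⟩, ?_, ?_, ?_⟩
  · linear_combination (f32 + f33 - f31) / 2
  · linear_combination (f31 + f33 - f32) / 2
  · linear_combination (f31 + f32 - f33) / 2
  · linear_combination (f22 + f23 - f21) / 2
  · linear_combination (f21 + f23 - f22) / 2
  · linear_combination (f21 + f22 - f23) / 2

end Summit.ValiantsHypothesis.ValiantsHypothesis.Theorems.SymPencilPerFourW2TwoRow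

end
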